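import Literature.Probability.LatticeModels.LocalPerturbationPolymerGas
import HarnessLib

/-!
# Local perturbations of a finite-range dependent reference process: Gaussian references

`Literature/Probability/LatticeModels/`; supplies the finite-range dependence hypothesis of
`LocalPerturbationPolymerGas` (`IsLocalPerturbation.indep`) for **Gaussian fields with a
finite-range covariance** — "the finite-range property: the restrictions of the field to sets
separated by more than the range are independent" (Brydges–Guadagni–Mitter 2004, §1;
Bauerschmidt–Brydges–Slade 2019, §3.3 and Exercise 3.3.3), which is what makes each
renormalisation-group step with a finite-range fluctuation covariance factorise over polymers.

For a real Gaussian process `X : Λ → Ω → ℝ` (Mathlib's `IsGaussianProcess`, all coordinates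
measurable):

* `indep_iSup_comap_of_isGaussianProcess`: if `cov[X a, X b] = 0` for all `a ∈ S₁`, `b ∈ S₂`,
  then the σ-algebras generated by `(X a)_{a ∈ S₁}` and `(X b)_{b ∈ S₂}` are independent
  (Mathlib's `IsGaussianProcess.indepFun_of_covariance_eq_zero` for the two restricted processes,
  transported to `⨆`-σ-algebras by antitonicity of `Indep`);
* `indep_cells_of_isGaussianProcess`: with cells `p : V` carrying finite site sets `verts p`, a
  "closeness" relation on sites off which covariances vanish, and an adjacency `R` on cells such
  that cells with close sites are equal or adjacent, **non-touching cell sets generate independent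
  σ-algebras** `⨆_{p ∈ K} ⨆_{a ∈ verts p} σ(X a)`;
* `IsLocalPerturbation.of_isGaussianProcess`: hence block-local bounded cell factors form an
  `IsLocalPerturbation` (and all results of `LocalPerturbationPolymerGas` /
  `LocalPerturbationObservables*` apply);
* `isGaussianProcess_eval_multivariateGaussian`, `indep_cells_multivariateGaussian`: the case of
  Mathlib's centred multivariate Gaussian `N(0, S)` on `EuclideanSpace ℝ ι` with a covariance
  matrix `S` of finite range for a "distance" `d` (`S a b = 0` if `ρ < d a b`), cells = blocks,
  `R` = blocks at `d`-distance `≤ ρ`.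

Everything is proved.

## Mathlib anchors

`IsGaussianProcess`, `IsGaussianProcess.comp_right`, `IsGaussianProcess.indepFun_of_covariance_eq_zero`,
`IndepFun_iff_Indep`, `indep_of_indep_of_le_left/right`, `Measurable.of_comap_le`,
`Measurable.comap_le`, `measurable_pi_apply`, `multivariateGaussian`,
`covariance_eval_multivariateGaussian`, `IsGaussian.hasGaussianLaw_id`, `HasGaussianLaw.map`,
`EuclideanSpace.proj`, `ContinuousLinearMap.pi`.

## References

* D. Brydges, G. Guadagni, P. K. Mitter, *Finite range decomposition of Gaussian processes*,
  J. Stat. Phys. 115 (2004) 415–449, §1. [BrydgesGuadagniMitter2004]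
* R. Bauerschmidt, D. Brydges, G. Slade, *Introduction to a Renormalisation Group Method*,
  LNM 2242 (2019), §3.3. [BauerschmidtBrydgesSlade2019]
-/

noncomputable section

open _root_.MeasureTheory _root_.ProbabilityTheory Finset
open scoped BigOperators

namespace Literature.Probability.LatticeModels

variable {V : Type*} {Ω : Type*} {mΩ : MeasurableSpace Ω} {μ : Measure Ω} {Λ : Type*}

/-! ### Independence of uncorrelated coordinate families of a Gaussian process -/

/-- Each coordinate of `S` is measurable for the σ-algebra generated by the restricted process
`ω ↦ (X a ω)_{a ∈ S}`. [folklore] -/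
theorem comap_le_comap_restrict (X : Λ → Ω → ℝ) (S : Finset Λ) {a : Λ} (ha : a ∈ S) :
    MeasurableSpace.comap (X a) inferInstance ≤
      MeasurableSpace.comap (fun ω (b : S) => X b ω) MeasurableSpace.pi := by
  have hproc : Measurable[MeasurableSpace.comap (fun ω (b : S) => X b ω) MeasurableSpace.pi]
      (fun ω (b : S) => X b ω) := Measurable.of_comap_le le_rfl
  have hXa : Measurable[MeasurableSpace.comap (fun ω (b : S) => X b ω) MeasurableSpace.pi]
      (X a) := (measurable_pi_apply (⟨a, ha⟩ : S)).comp hproc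
  exact hXa.comap_le

/-- The σ-algebra of finitely many coordinates is below that of the restricted process.
[folklore] -/
theorem iSup_comap_le_comap_restrict (X : Λ → Ω → ℝ) (S : Finset Λ) :
    (⨆ a ∈ S, MeasurableSpace.comap (X a) inferInstance) ≤
      MeasurableSpace.comap (fun ω (b : S) => X b ω) MeasurableSpace.pi :=
  iSup₂_le fun _ ha => comap_le_comap_restrict X S ha

/-- **Uncorrelated coordinate families of a Gaussian process generate independent σ-algebras.**
If `X` is a real Gaussian process with measurable coordinates and `cov[X a, X b] = 0` for all
`a ∈ S₁`, `b ∈ S₂`, then `σ(X a : a ∈ S₁)` and `σ(X b : b ∈ S₂)` are independent.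
[cite: BauerschmidtBrydgesSlade2019, §3.3 (Exercise 3.3.3)] -/
theorem indep_iSup_comap_of_isGaussianProcess {X : Λ → Ω → ℝ} (hX : IsGaussianProcess X μ)
    (hmeas : ∀ a, Measurable (X a)) {S₁ S₂ : Finset Λ}
    (hcov : ∀ a ∈ S₁, ∀ b ∈ S₂, cov[X a, X b; μ] = 0) :
    Indep (⨆ a ∈ S₁, MeasurableSpace.comap (X a) inferInstance)
      (⨆ b ∈ S₂, MeasurableSpace.comap (X b) inferInstance) μ := by
  -- the two restricted processes are jointly Gaussian
  have hG : IsGaussianProcess (Sum.elim (fun a : S₁ => X a) (fun b : S₂ => X b)) μ := by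
    have h := hX.comp_right (Sum.elim (Subtype.val : S₁ → Λ) (Subtype.val : S₂ → Λ))
    rwa [Sum.comp_elim] at h
  have hind : IndepFun (fun ω (a : S₁) => X a ω) (fun ω (b : S₂) => X b ω) μ :=
    hG.indepFun_of_covariance_eq_zero (fun a => (hmeas a).aemeasurable)
      (fun b => (hmeas b).aemeasurable) fun a b => hcov a a.2 b b.2
  rw [IndepFun_iff_Indep] at hind
  exact indep_of_indep_of_le_right
    (indep_of_indep_of_le_left hind (iSup_comap_le_comap_restrict X S₁))
    (iSup_comap_le_comap_restrict X S₂)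

/-! ### Cells made of sites: non-touching cell sets are independent -/

section Cells

variable [DecidableEq Λ]

/-- **Finite-range dependence of a Gaussian field, cell form.** Cells `p` carry finite site sets
`verts p`; covariances vanish between sites that are not `close`; cells containing close sites are
equal or `R`-adjacent. Then cell sets that do not touch generate independent σ-algebras.
[cite: BrydgesGuadagniMitter2004, §1; BauerschmidtBrydgesSlade2019, §3.3] -/
theorem indep_cells_of_isGaussianProcess {X : Λ → Ω → ℝ} (hX : IsGaussianProcess X μ)
    (hmeas : ∀ a, Measurable (X a)) (close : Λ → Λ → Prop)
    (hcov : ∀ a b, ¬ close a b → cov[X a, X b; μ] = 0) (verts : V → Finset Λ) {R : V → V → Prop}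
    (hR : ∀ p q, ∀ a ∈ verts p, ∀ b ∈ verts q, close a b → p = q ∨ R p q)
    (K₁ K₂ : Finset V) (hK : ¬ Touches R K₁ K₂) :
    Indep (⨆ p ∈ K₁, ⨆ a ∈ verts p, MeasurableSpace.comap (X a) inferInstance)
      (⨆ p ∈ K₂, ⨆ a ∈ verts p, MeasurableSpace.comap (X a) inferInstance) μ := by
  have h1 : (⨆ p ∈ K₁, ⨆ a ∈ verts p, MeasurableSpace.comap (X a) inferInstance) =
      ⨆ a ∈ cellSupp verts K₁, MeasurableSpace.comap (X a) inferInstance := by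
    unfold cellSupp; rw [Finset.iSup_biUnion]
  have h2 : (⨆ p ∈ K₂, ⨆ a ∈ verts p, MeasurableSpace.comap (X a) inferInstance) =
      ⨆ a ∈ cellSupp verts K₂, MeasurableSpace.comap (X a) inferInstance := by
    unfold cellSupp; rw [Finset.iSup_biUnion]
  rw [h1, h2]
  refine indep_iSup_comap_of_isGaussianProcess hX hmeas fun a ha b hb => hcov a b fun hab => hK ?_
  obtain ⟨p, hp, hap⟩ := mem_cellSupp.1 ha
  obtain ⟨q, hq, hbq⟩ := mem_cellSupp.1 hb
  exact ⟨p, hp, q, hq, hR p q a hap b hbq hab⟩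

/-- **Gaussian references are finite-range dependent references**: block-local bounded cell
factors over a Gaussian field with finite-range covariance form an `IsLocalPerturbation` (so the
polymer expansion, zero-freeness, exclusion costs and observable bounds of
`LocalPerturbationPolymerGas` / `LocalPerturbationObservables*` apply).
[cite: BauerschmidtBrydgesSlade2019, §3.3] -/
theorem IsLocalPerturbation.of_isGaussianProcess {X : Λ → Ω → ℝ} (hX : IsGaussianProcess X μ)
    (hmeas : ∀ a, Measurable (X a)) (close : Λ → Λ → Prop)
    (hcov : ∀ a b, ¬ close a b → cov[X a, X b; μ] = 0) (verts : V → Finset Λ) {R : V → V → Prop}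
    (hR : ∀ p q, ∀ a ∈ verts p, ∀ b ∈ verts q, close a b → p = q ∨ R p q)
    {g : V → Ω → ℂ} {ε : ℝ} (hε : 0 ≤ ε)
    (hg : ∀ p, Measurable[⨆ a ∈ verts p, MeasurableSpace.comap (X a) inferInstance] (g p))
    (hgε : ∀ p ω, ‖g p ω‖ ≤ ε) :
    IsLocalPerturbation μ R (fun p => ⨆ a ∈ verts p, MeasurableSpace.comap (X a) inferInstance)
      g ε where
  le _ := iSup₂_le fun a _ => (hmeas a).comap_le
  indep K₁ K₂ hK := indep_cells_of_isGaussianProcess hX hmeas close hcov verts hR K₁ K₂ hK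
  measurable := hg
  norm_le := hgε
  nonneg := hε

end Cells

/-! ### Mathlib's centred multivariate Gaussian with a finite-range covariance matrix -/

section Multivariate

variable {ι : Type*} [Fintype ι] [DecidableEq ι]

/-- The coordinate process of `N(m, S)` on `EuclideanSpace ℝ ι` is a Gaussian process. [folklore] -/
theorem isGaussianProcess_eval_multivariateGaussian (m : EuclideanSpace ℝ ι) (S : Matrix ι ι ℝ) :
    IsGaussianProcess (fun (i : ι) (z : EuclideanSpace ℝ ι) => z i) (multivariateGaussian m S) := by
  refine ⟨fun I => ?_⟩
  set L : EuclideanSpace ℝ ι →L[ℝ] (I → ℝ) :=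
    ContinuousLinearMap.pi fun i : I => (EuclideanSpace.proj (i : ι) : EuclideanSpace ℝ ι →L[ℝ] ℝ)
    with hL
  have hid : HasGaussianLaw (id : EuclideanSpace ℝ ι → EuclideanSpace ℝ ι) (multivariateGaussian m S) :=
    IsGaussian.hasGaussianLaw_id
  have h := hid.map L
  have hfun : (L ∘ id : EuclideanSpace ℝ ι → I → ℝ) =
      fun z : EuclideanSpace ℝ ι => I.restrict fun i => z i := by
    funext z; funext i; rfl
  rwa [hfun] at h

/-- **Finite-range covariance ⇒ finite-range dependence for `N(0, S)`**: if `S` is positive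
semidefinite with `S a b = 0` whenever `ρ < d a b`, cells carry blocks `verts p`, and `R p q` holds
whenever some sites `a ∈ verts p`, `b ∈ verts q` have `d a b ≤ ρ` and `p ≠ q`, then non-touching
cell sets generate independent σ-algebras under `N(0, S)`.
[cite: BrydgesGuadagniMitter2004, §1; BauerschmidtBrydgesSlade2019, §3.3] -/
theorem indep_cells_multivariateGaussian {S : Matrix ι ι ℝ} (hS : S.PosSemidef) (d : ι → ι → ℕ)
    (ρ : ℕ) (hfr : ∀ a b, ρ < d a b → S a b = 0) (verts : V → Finset ι) {R : V → V → Prop}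
    (hR : ∀ p q, p ≠ q → ∀ a ∈ verts p, ∀ b ∈ verts q, d a b ≤ ρ → R p q)
    (K₁ K₂ : Finset V) (hK : ¬ Touches R K₁ K₂) :
    Indep (μ := multivariateGaussian 0 S)
      (⨆ p ∈ K₁, ⨆ a ∈ verts p,
        MeasurableSpace.comap (fun z : EuclideanSpace ℝ ι => z a) inferInstance)
      (⨆ p ∈ K₂, ⨆ a ∈ verts p,
        MeasurableSpace.comap (fun z : EuclideanSpace ℝ ι => z a) inferInstance) := by
  refine indep_cells_of_isGaussianProcess (isGaussianProcess_eval_multivariateGaussian 0 S)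
    (fun a => ?_) (fun a b => d a b ≤ ρ) (fun a b hab => ?_) verts (fun p q a ha b hb hab => ?_)
    K₁ K₂ hK
  · fun_prop
  · rw [covariance_eval_multivariateGaussian hS]
    exact hfr a b (not_le.1 hab)
  · by_cases hpq : p = q
    · exact Or.inl hpq
    · exact Or.inr (hR p q hpq a ha b hb hab)

/-- The packaged form: block-local bounded cell factors over `N(0, S)` with `S` of finite range
form an `IsLocalPerturbation`. [cite: BauerschmidtBrydgesSlade2019, §3.3] -/
theorem IsLocalPerturbation.multivariateGaussian {S : Matrix ι ι ℝ} (hS : S.PosSemidef)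
    (d : ι → ι → ℕ) (ρ : ℕ) (hfr : ∀ a b, ρ < d a b → S a b = 0) (verts : V → Finset ι)
    {R : V → V → Prop} (hR : ∀ p q, p ≠ q → ∀ a ∈ verts p, ∀ b ∈ verts q, d a b ≤ ρ → R p q)
    {g : V → EuclideanSpace ℝ ι → ℂ} {ε : ℝ} (hε : 0 ≤ ε)
    (hg : ∀ p, Measurable[⨆ a ∈ verts p,
      MeasurableSpace.comap (fun z : EuclideanSpace ℝ ι => z a) inferInstance] (g p))
    (hgε : ∀ p z, ‖g p z‖ ≤ ε) :
    IsLocalPerturbation (multivariateGaussian 0 S) R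
      (fun p => ⨆ a ∈ verts p,
        MeasurableSpace.comap (fun z : EuclideanSpace ℝ ι => z a) inferInstance) g ε where
  le _ := iSup₂_le fun a _ =>
    (show Measurable (fun z : EuclideanSpace ℝ ι => z a) by fun_prop).comap_le
  indep K₁ K₂ hK := indep_cells_multivariateGaussian hS d ρ hfr verts hR K₁ K₂ hK
  measurable := hg
  norm_le := hgε
  nonneg := hε

end Multivariate

end Literature.Probability.LatticeModels
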